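import Summits.ValiantsHypothesis.ValiantsHypothesis.Theorems.BarrierLeverAnchoredDoorHitsLowerPairsThinStep
import Summits.ValiantsHypothesis.ValiantsHypothesis.Theorems.BarrierLeverAnchoredDoorHitsLowerPairsMono
import Summits.ValiantsHypothesis.ValiantsHypothesis.Theorems.BarrierLeverAnchoredDoorHitsLowerPairsStubGenericPoint
import Mathlib.Combinatorics.Enumerative.DoubleCounting
import Literature.Computability.Complexity.RossmanMonotoneCliqueGraphs

/-!
# Support item `AnchoredDoorHitsLowerPairs` (stmt-ValiantsHypothesis-22510), line `anchored-peeling`: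
# U1 FOR GRAPH PAIRS — the anchored door 𝔄₁ hits EVERY pair of 1-dimensional simplicial complexes, at every height

Helper file (`--supports stmt-ValiantsHypothesis-22510`; cell valiant-natproofs, rung V4, 𝒟-side door (c); registered line
`Cruxes/AnchoredDoorHitsLowerPairs/Lines/anchored_peeling.lean` v5; prover seat val-np-p2 gen 11). Definition-free. Closes NO item.

**THEOREM (`symbolicDet_one_ne_zero_of_graphs`).** For every `h`, every injective layout `(u, w)` whose rows AND columns form simplicial
complexes of dimension `≤ 1` (lower families of faces of size `≤ 2`: graphs with their vertices, edges and the empty face) has nonzero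
profile-1 symbolic anchored minor: `symbolicDet 1 h r u w ≠ 0`; hence (`symbolicDet_ne_zero_of_graphs`) nonzero at every profile
`s ≥ 1` and (`anchoredHit_of_graphs`) the layout is an `AnchoredHit`. This is conjecture U1 of the line (⟺ the registered stub
`stub_vertexStep`, given val-np-p2 g10's transfer p585247) on the whole class of GRAPH PAIRS — the class singled out as the first honest
test of U1 beyond the Hall regime in val-np-p1 g16's memo RIGID-FAMILY-Pn §7; it contains infinitely many star(1)-RIGID pairs (e.g.
`K_{1,n}` versus `K_{p,q}` with `(p+1)(q+1) = 2n+2`), on which the line's peeling `stub_starStep` has no move.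

PROOF = THIN VERTEX STEPS ALL THE WAY DOWN (`…ThinStep`, part 4). Strong induction on `r`. If no row has a vertex, `r ≤ 1` and
`stub_base` applies. Otherwise pick a row-vertex `a` with the FEWEST rows through it, `1 + δ` of them (`δ` = its degree in the row graph).
COUNTING (`exists_thin_vertex`): if `v` denotes the number of column vertices, then `1 + δ ≤ v` — for otherwise every row-vertex has degree
`≥ δ ≥ v`, so there are `≥ δ + 1 ≥ v + 1` row-vertices (the neighbours of `a` and `a`) and, by double counting vertex–edge incidences
(`Finset.card_mul_le_card_mul`), `2·#edges ≥ (v+1)·v`; but rows and columns are equinumerous and the columns are faces of size `≤ 2` on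
`v` vertices, so `#row-vertices + #row-edges ≤ v + v(v−1)/2`, a contradiction. Hence `a` is THIN and the thin vertex step reduces to the
deletion pairs, which are again graph pairs with fewer rows.

WHAT THIS IS NOT: pairs with a face of size `≥ 3` on either side are untouched (the thick vertices of U1 live there); nothing on items
22510 / 19717 themselves, on crux stmt-ValiantsHypothesis-14610, or on `VP` versus `VNP`.
-/

set_option linter.dupNamespace false

namespace Summit.ValiantsHypothesis.ValiantsHypothesis.Theorems.BarrierLever.AnchoredPeeling

open Finset MvPolynomial

noncomputable section

namespace ThinStep

variable {h : ℕ}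

/-! ## 1. Counting in graph complexes -/

section Counting

variable {r : ℕ}

/-- In an injective family, the rows through `a` are counted by the faces through `a` in the image. -/
theorem card_filter_mem_eq_card_image {u : Fin r → Finset (Fin h)} (hu : Function.Injective u) (a : Fin h) :
    (univ.filter (fun i => a ∈ u i)).card = ((univ.image u).filter (fun S => a ∈ S)).card := by
  classical
  rw [← Finset.card_image_of_injective (univ.filter (fun i => a ∈ u i)) hu]
  congr 1
  ext S
  simp only [Finset.mem_image, Finset.mem_filter, Finset.mem_univ, true_and]
  constructor
  · rintro ⟨i, hi, rfl⟩; exact ⟨⟨i, rfl⟩, hi⟩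
  · rintro ⟨⟨i, rfl⟩, hi⟩; exact ⟨i, hi, rfl⟩

/-- A lower family of faces of size `≤ 2` on the vertex set `V` has at most `1 + |V| + C(|V|, 2)` members. -/
theorem card_le_of_graph (R : Finset (Finset (Fin h))) (V : Finset (Fin h)) (hcard : ∀ S ∈ R, S.card ≤ 2)
    (hV : ∀ S ∈ R, S ⊆ V) : R.card ≤ 1 + V.card + V.card.choose 2 := by
  classical
  have hsub : R ⊆ V.powersetCard 0 ∪ V.powersetCard 1 ∪ V.powersetCard 2 := by
    intro S hS
    have h2 := hcard S hS
    simp only [Finset.mem_union, Finset.mem_powersetCard]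
    rcases Nat.lt_or_ge S.card 1 with h0 | h1
    · exact Or.inl (Or.inl ⟨hV S hS, by omega⟩)
    · rcases Nat.lt_or_ge S.card 2 with h1' | h2'
      · exact Or.inl (Or.inr ⟨hV S hS, by omega⟩)
      · exact Or.inr ⟨hV S hS, by omega⟩
  calc R.card ≤ (V.powersetCard 0 ∪ V.powersetCard 1 ∪ V.powersetCard 2).card := Finset.card_le_card hsub
    _ ≤ (V.powersetCard 0 ∪ V.powersetCard 1).card + (V.powersetCard 2).card := Finset.card_union_le _ _
    _ ≤ (V.powersetCard 0).card + (V.powersetCard 1).card + (V.powersetCard 2).card :=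
        Nat.add_le_add_right (Finset.card_union_le _ _) _
    _ = 1 + V.card + V.card.choose 2 := by
        rw [Finset.card_powersetCard, Finset.card_powersetCard, Finset.card_powersetCard, Nat.choose_zero_right,
          Nat.choose_one_right]

/-- **The thin vertex of a graph pair.** Rows `R` and columns `Cw` are lower families of faces of size `≤ 2`, equinumerous, and some
row is nonempty. Then some row-vertex `a` has `#{S ∈ R : a ∈ S} ≤ #{c : {c} ∈ Cw}`. -/
theorem exists_thin_vertex (R Cw : Finset (Finset (Fin h))) (hRl : IsLowerSet (↑R : Set (Finset (Fin h))))
    (hCl : IsLowerSet (↑Cw : Set (Finset (Fin h)))) (hR2 : ∀ S ∈ R, S.card ≤ 2) (hC2 : ∀ T ∈ Cw, T.card ≤ 2)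
    (heq : R.card = Cw.card) (hne : ∃ S ∈ R, S.Nonempty) :
    ∃ a : Fin h, {a} ∈ R ∧ (R.filter (fun S => a ∈ S)).card ≤ (univ.filter (fun c : Fin h => {c} ∈ Cw)).card := by
  classical
  -- row vertices, row edges, column vertices
  set A : Finset (Fin h) := univ.filter (fun a : Fin h => {a} ∈ R) with hA
  set E : Finset (Finset (Fin h)) := R.filter (fun S => S.card = 2) with hE
  set V : Finset (Fin h) := univ.filter (fun c : Fin h => {c} ∈ Cw) with hVdef
  have hAne : A.Nonempty := by
    obtain ⟨S, hS, ⟨a, ha⟩⟩ := hne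
    exact ⟨a, Finset.mem_filter.mpr ⟨Finset.mem_univ _, hRl (Finset.singleton_subset_iff.mpr ha) hS⟩⟩
  -- the star of a row-vertex: itself plus its edges
  have hstar : ∀ a ∈ A, R.filter (fun S => a ∈ S) = insert {a} (E.filter (fun S => a ∈ S)) := by
    intro a ha
    have haR : {a} ∈ R := (Finset.mem_filter.mp ha).2
    ext S
    simp only [Finset.mem_filter, Finset.mem_insert, hE]
    constructor
    · rintro ⟨hS, haS⟩
      have h2 := hR2 S hS
      have h1 : 1 ≤ S.card := Finset.card_pos.mpr ⟨a, haS⟩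
      by_cases hS1 : S.card = 1
      · left
        obtain ⟨x, hx⟩ := Finset.card_eq_one.mp hS1
        rw [hx] at haS
        rw [hx, Finset.mem_singleton.mp haS]
      · right
        exact ⟨⟨hS, by omega⟩, haS⟩
    · rintro (rfl | ⟨⟨hS, -⟩, haS⟩)
      · exact ⟨haR, Finset.mem_singleton_self a⟩
      · exact ⟨hS, haS⟩
  have hstar_card : ∀ a ∈ A, (R.filter (fun S => a ∈ S)).card = (E.filter (fun S => a ∈ S)).card + 1 := by
    intro a ha
    rw [hstar a ha, Finset.card_insert_of_notMem]
    intro hmem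
    have := (Finset.mem_filter.mp (Finset.mem_filter.mp hmem).1).2
    rw [Finset.card_singleton] at this
    exact absurd this (by norm_num)
  -- degree bound: the edges at `a` inject into the other row-vertices
  have hdeg_le : ∀ a ∈ A, (E.filter (fun S => a ∈ S)).card + 1 ≤ A.card := by
    intro a ha
    have hother : ∀ S ∈ E.filter (fun S => a ∈ S), ∃ b, b ≠ a ∧ S = {a, b} := by
      intro S hS
      obtain ⟨hSE, haS⟩ := Finset.mem_filter.mp hS
      have hS2 : S.card = 2 := (Finset.mem_filter.mp hSE).2
      obtain ⟨x, y, hxy, rfl⟩ := Finset.card_eq_two.mp hS2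
      rcases Finset.mem_insert.mp haS with rfl | hy
      · exact ⟨y, hxy.symm, rfl⟩
      · rw [Finset.mem_singleton.mp hy]
        exact ⟨x, hxy, Finset.pair_comm x y⟩
    haveI : Nonempty (Fin h) := ⟨a⟩
    choose! f hf using hother
    have hmaps : ∀ S ∈ E.filter (fun S => a ∈ S), f S ∈ A.erase a := by
      intro S hS
      obtain ⟨hne', hSeq⟩ := hf S hS
      have hSR : S ∈ R := (Finset.mem_filter.mp (Finset.mem_filter.mp hS).1).1
      have hfS : f S ∈ ({a, f S} : Finset (Fin h)) := Finset.mem_insert_of_mem (Finset.mem_singleton_self _)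
      rw [← hSeq] at hfS
      exact Finset.mem_erase.mpr ⟨hne', Finset.mem_filter.mpr ⟨Finset.mem_univ _,
        hRl (Finset.singleton_subset_iff.mpr hfS) hSR⟩⟩
    have hinj : Set.InjOn f ↑(E.filter (fun S => a ∈ S)) := by
      intro S hS S' hS' hSS'
      rw [(hf S hS).2, (hf S' hS').2, hSS']
    have := Finset.card_le_card_of_injOn f hmaps hinj
    rw [Finset.card_erase_of_mem ha] at this
    have hApos : 0 < A.card := Finset.card_pos.mpr ⟨a, ha⟩
    omega
  -- the vertex of minimum star
  obtain ⟨a, ha, hmin⟩ := Finset.exists_min_image A (fun a => (E.filter (fun S => a ∈ S)).card) hAne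
  refine ⟨a, (Finset.mem_filter.mp ha).2, ?_⟩
  rw [hstar_card a ha]
  by_contra hlt
  push Not at hlt
  set δ := (E.filter (fun S => a ∈ S)).card with hδ
  set v := V.card with hv
  -- (F5) many row-vertices
  have hF5 : δ + 1 ≤ A.card := hdeg_le a ha
  -- (F4) double counting vertex–edge incidences: `|A|·δ ≤ 2·|E|`
  have hF4 : A.card * δ ≤ E.card * 2 := by
    refine Finset.card_mul_le_card_mul (fun (b : Fin h) (S : Finset (Fin h)) => b ∈ S) (fun b hb => ?_) (fun S hS => ?_)
    · have := hmin b hb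
      rw [Finset.bipartiteAbove]; exact this
    · rw [Finset.bipartiteBelow]
      have hS2 : S.card = 2 := (Finset.mem_filter.mp hS).2
      calc (A.filter (fun b => b ∈ S)).card ≤ S.card := Finset.card_le_card (fun b hb => (Finset.mem_filter.mp hb).2)
        _ = 2 := hS2
  -- (F1) rows: `1 + |A| + |E| ≤ |R|`
  have hF1 : 1 + A.card + E.card ≤ R.card := by
    have hsub : insert ∅ (A.image (fun a => ({a} : Finset (Fin h))) ∪ E) ⊆ R := by
      intro S hS
      rcases Finset.mem_insert.mp hS with rfl | hS'
      · obtain ⟨S₀, hS₀, -⟩ := hne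
        exact hRl (Finset.empty_subset S₀) hS₀
      · rcases Finset.mem_union.mp hS' with hS'' | hS''
        · obtain ⟨b, hb, rfl⟩ := Finset.mem_image.mp hS''
          exact (Finset.mem_filter.mp hb).2
        · exact (Finset.mem_filter.mp hS'').1
    have hdisj : Disjoint (A.image (fun a => ({a} : Finset (Fin h)))) E := by
      rw [Finset.disjoint_left]
      intro S hS hSE
      obtain ⟨b, -, rfl⟩ := Finset.mem_image.mp hS
      have := (Finset.mem_filter.mp hSE).2
      rw [Finset.card_singleton] at this
      exact absurd this (by norm_num)
    have hnot : ∅ ∉ A.image (fun a => ({a} : Finset (Fin h))) ∪ E := by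
      intro h0
      rcases Finset.mem_union.mp h0 with h0 | h0
      · obtain ⟨b, -, hb⟩ := Finset.mem_image.mp h0
        exact Finset.singleton_ne_empty b hb
      · have := (Finset.mem_filter.mp h0).2
        rw [Finset.card_empty] at this
        exact absurd this (by norm_num)
    have := Finset.card_le_card hsub
    rw [Finset.card_insert_of_notMem hnot, Finset.card_union_of_disjoint hdisj,
      Finset.card_image_of_injective _ Finset.singleton_injective] at this
    omega
  -- (F2) columns: `|Cw| ≤ 1 + v + C(v,2)`
  have hF2 : Cw.card ≤ 1 + v + v.choose 2 := by
    refine card_le_of_graph Cw V hC2 (fun T hT c hc => ?_)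
    exact Finset.mem_filter.mpr ⟨Finset.mem_univ _, hCl (Finset.singleton_subset_iff.mpr hc) hT⟩
  have hF3 := Literature.Computability.Complexity.two_mul_choose_two_add v
  -- contradiction
  have h1 : A.card * (v + 2) ≤ v * (v + 1) := by nlinarith
  have h2 : (v + 1) * (v + 2) ≤ A.card * (v + 2) := Nat.mul_le_mul_right _ (by omega)
  nlinarith

end Counting

/-! ## 2. The induction -/

section Induction

variable {r : ℕ}

/-- An injective `Fin r`-family has an image of size `r`. -/
theorem card_image_univ_of_injective {u : Fin r → Finset (Fin h)} (hu : Function.Injective u) :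
    (Finset.univ.image u).card = r := by
  classical
  rw [Finset.card_image_of_injective _ hu, Finset.card_univ, Fintype.card_fin]

/-- The deletion pair at a vertex lying in some row is strictly smaller. -/
theorem lt_of_deletion_range {r₀ : ℕ} {u : Fin r → Finset (Fin h)} {u₀ : Fin r₀ → Finset (Fin h)}
    (hu : Function.Injective u) (hu₀ : Function.Injective u₀) {a : Fin h} {i : Fin r} (hia : a ∈ u i)
    (hr₀ : Set.range u₀ = {S | S ∈ Set.range u ∧ a ∉ S}) : r₀ < r := by
  classical
  have hss : Finset.univ.image u₀ ⊂ Finset.univ.image u := by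
    rw [Finset.ssubset_iff_subset_ne]
    refine ⟨?_, ?_⟩
    · intro x hx
      rw [Finset.mem_image] at hx ⊢
      obtain ⟨j, _, rfl⟩ := hx
      have hj : u₀ j ∈ Set.range u₀ := ⟨j, rfl⟩
      rw [hr₀] at hj
      obtain ⟨k, hk⟩ := hj.1
      exact ⟨k, Finset.mem_univ _, hk⟩
    · intro heq
      have hui : u i ∈ Finset.univ.image u₀ := by
        rw [heq, Finset.mem_image]; exact ⟨i, Finset.mem_univ _, rfl⟩
      rw [Finset.mem_image] at hui
      obtain ⟨j, _, hj⟩ := hui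
      have hj' : u₀ j ∈ Set.range u₀ := ⟨j, rfl⟩
      rw [hr₀] at hj'
      exact hj'.2 (hj ▸ hia)
  have := Finset.card_lt_card hss
  rwa [card_image_univ_of_injective hu₀, card_image_univ_of_injective hu] at this

/-- The deletion rows again form a lower set. -/
theorem lowerSet_deletion_range {r₀ : ℕ} {u : Fin r → Finset (Fin h)} {u₀ : Fin r₀ → Finset (Fin h)}
    (hlu : IsLowerSet (Set.range u)) (a : Fin h)
    (hr₀ : Set.range u₀ = {S | S ∈ Set.range u ∧ a ∉ S}) : IsLowerSet (Set.range u₀) := by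
  rw [hr₀]
  intro S T hTS hS
  exact ⟨hlu hTS hS.1, fun haT => hS.2 (hTS haT)⟩

/-- If no row contains a vertex, an injective family has at most one row. -/
theorem le_one_of_no_vertex {u : Fin r → Finset (Fin h)} (hu : Function.Injective u)
    (hex : ∀ (i : Fin r) (a : Fin h), a ∉ u i) : r ≤ 1 := by
  by_contra hr
  push Not at hr
  have h01 : u ⟨0, by omega⟩ = u ⟨1, by omega⟩ := by
    rw [Finset.eq_empty_iff_forall_notMem.mpr (hex _), Finset.eq_empty_iff_forall_notMem.mpr (hex _)]
  have := hu h01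
  simp [Fin.ext_iff] at this

end Induction

/-- **U1 for graph pairs** (see the module docstring): profile 1, every `h`. -/
theorem symbolicDet_one_ne_zero_of_graphs (h : ℕ) :
    ∀ (r : ℕ) (u w : Fin r → Finset (Fin h)), Function.Injective u → Function.Injective w →
      IsLowerSet (Set.range u) → IsLowerSet (Set.range w) → (∀ i, (u i).card ≤ 2) → (∀ j, (w j).card ≤ 2) →
      symbolicDet 1 h r u w ≠ 0 := by
  classical
  intro r
  induction r using Nat.strong_induction_on with
  | _ r ih =>
    intro u w hu hw hlu hlw hu2 hw2
    by_cases hex : ∃ (i : Fin r) (a : Fin h), a ∈ u i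
    · obtain ⟨i₀, a₀, hia₀⟩ := hex
      -- the thin vertex
      obtain ⟨a, haR, hthin⟩ := exists_thin_vertex (Finset.univ.image u) (Finset.univ.image w)
        (by rw [Finset.coe_image, Finset.coe_univ, Set.image_univ]; exact hlu)
        (by rw [Finset.coe_image, Finset.coe_univ, Set.image_univ]; exact hlw)
        (fun S hS => by obtain ⟨i, -, rfl⟩ := Finset.mem_image.mp hS; exact hu2 i)
        (fun T hT => by obtain ⟨j, -, rfl⟩ := Finset.mem_image.mp hT; exact hw2 j)
        (by rw [card_image_univ_of_injective hu, card_image_univ_of_injective hw])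
        ⟨u i₀, Finset.mem_image.mpr ⟨i₀, Finset.mem_univ _, rfl⟩, ⟨a₀, hia₀⟩⟩
      have hthin' : (Finset.univ.filter (fun i => a ∈ u i)).card ≤
          (Finset.univ.filter (fun c : Fin h => ∃ j, w j = {c})).card := by
        rw [card_filter_mem_eq_card_image hu a]
        refine hthin.trans (le_of_eq ?_)
        congr 1
        ext c
        simp only [Finset.mem_filter, Finset.mem_univ, true_and, Finset.mem_image]
      refine symbolicDet_ne_zero_of_thin 1 h r le_rfl u w hu hw hlw a hthin' ?_
      intro r₀ u₀ w₀ hu₀ hw₀ hru₀ hrw₀ hlw₀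
      obtain ⟨i, -, hi⟩ := Finset.mem_image.mp haR
      have hia : a ∈ u i := by rw [hi]; exact Finset.mem_singleton_self a
      refine ih r₀ (lt_of_deletion_range hu hu₀ hia hru₀) u₀ w₀ hu₀ hw₀ (lowerSet_deletion_range hlu a hru₀) hlw₀
        (fun k => ?_) (fun k => ?_)
      · have hk : u₀ k ∈ Set.range u₀ := ⟨k, rfl⟩
        rw [hru₀] at hk
        obtain ⟨⟨i', hi'⟩, -⟩ := hk
        rw [← hi']; exact hu2 i'
      · obtain ⟨j', hj'⟩ := hrw₀ ⟨k, rfl⟩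
        rw [← hj']; exact hw2 j'
    · push Not at hex
      exact stub_base 1 h r u w hu hw hlu hlw (le_one_of_no_vertex hu hex)

/-- The same at every profile `s ≥ 1` (the door 𝔄_s contains 𝔄₁, `symbolicDet_ne_zero_mono`). -/
theorem symbolicDet_ne_zero_of_graphs {s : ℕ} (hs : 1 ≤ s) (h r : ℕ) (u w : Fin r → Finset (Fin h))
    (hu : Function.Injective u) (hw : Function.Injective w) (hlu : IsLowerSet (Set.range u))
    (hlw : IsLowerSet (Set.range w)) (hu2 : ∀ i, (u i).card ≤ 2) (hw2 : ∀ j, (w j).card ≤ 2) :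
    symbolicDet s h r u w ≠ 0 :=
  symbolicDet_ne_zero_mono hs (symbolicDet_one_ne_zero_of_graphs h r u w hu hw hlu hlw hu2 hw2)

/-- Hence every graph pair is an `AnchoredHit` of 𝔄_s, `s ≥ 1` (generic point, p575512). -/
theorem anchoredHit_of_graphs {s : ℕ} (hs : 1 ≤ s) (h r : ℕ) (u w : Fin r → Finset (Fin h))
    (hu : Function.Injective u) (hw : Function.Injective w) (hlu : IsLowerSet (Set.range u))
    (hlw : IsLowerSet (Set.range w)) (hu2 : ∀ i, (u i).card ≤ 2) (hw2 : ∀ j, (w j).card ≤ 2) :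
    AnchoredHit s h r u w :=
  stub_genericPoint s h r u w (symbolicDet_ne_zero_of_graphs hs h r u w hu hw hlu hlw hu2 hw2)

end ThinStep

end

end Summit.ValiantsHypothesis.ValiantsHypothesis.Theorems.BarrierLever.AnchoredPeeling
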